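import Summits.Ventures.HSemireg.TwoSlotFrameTable
import Summits.Ventures.HSemireg.DegreeSixSecondDigit
import Summits.Ventures.HSemireg.CliqueUnitKills

/-!
# Glue: the digit identities on the exterior-algebra frame (pub-hsemireg, S4-PUSH corner 2; s4-ref g38 P-3, g39 VERDICT #8)

Composes `TwoSlotFrameTable` (the 2-vector ∕ atom tables) with `DegreeSixSecondDigit.lemmaB` ∕ `.obstruction` and
`CliqueUnitKills.T3_Km2235` (cell `pub-hsemireg`, seat s4-search-2 gens 13–14; memo
`s4push/search-2/g11/LIFT2-search-2-g11.md` §5, LEMMAS B ∕ A(a) ∕ D(b) of the hand analysis of the M2 edge unit).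

* Section `Frame` (any commutative ring): the identities on the h∕l-LEVEL frame — hypotheses are the ENTRIES of
  the 2-vector table that are needed (`hᵢ² = 0`, `hᵢlⱼ = 0`, `lⱼ² = 0`, `l₁l₄ = −h₀h₁`, `l₂l₃ = h₀h₁`, …) plus the
  DEFINITIONS of the atoms; the atom relations used by the companions (`H·H = 2H₂`, `S₁S₁ = 2S₂`, `HL = 0`, …) are
  derived inside from `TwoSlotFrameTable.pairSum_* ∕ slotSum_* ∕ crossLine_*`.  («atom table ⇒ identity»: kernel,
  under the table entries as hypotheses — s4-ref g39 VERDICT #8 §1.)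
* Section `Exterior` (Mathlib's `ExteriorAlgebra R M`, any commutative ring `R`, any module `M`, any twelve vectors
  `x₀, …, x₁₁`): the JOIN.  The subalgebra `Λ := Algebra.adjoin R {ι x · ι y}` generated by the 2-vectors
  — which IS the even part: `twoVectorSubalgebra_eq_even`, `Λ = CliffordAlgebra.even 0` for Mathlib's `ℤ/2`-grading
  of `ExteriorAlgebra R M = CliffordAlgebra 0` — is commutative (`isMulCommutative_twoVectorSubalgebra`, from
  `TwoSlotFrameTable.twoVector_comm` through Mathlib's `Algebra.isMulCommutative_adjoin`; the `CommRing`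
  structure is Mathlib's scoped `IsMulCommutative` instance), the table entries HOLD there (`TwoSlotFrameTable.twoVector_mul_self ∕ table_zero_* ∕ table_signed`),
  and the `Frame` theorems instantiated in `Λ` and pushed through the coercion `Λ → ExteriorAlgebra R M` give
  `lemmaB_exterior`, `obstruction_exterior`, `T3_Km2235_exterior`: the identities for the ACTUAL 2-vectors
  `hᵢ = ι x_{2i} ι x_{2i+1}`, `l₁ = ι x₀ ι x₂, l₂ = ι x₀ ι x₃, l₃ = ι x₁ ι x₂, l₄ = ι x₁ ι x₃`, with NO table entry
  among the hypotheses — only definitions (abbreviations) and the membership of the free parameters in `Λ`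
  (in the application `R = ℤ`, `M = ℤ¹² = H¹(E⁶, ℤ)`, the parameters are integers and `Y ∈ Λ^{ev}ℤ¹²`).  This is
  the chain «exterior-algebra table ⇒ atom table ⇒ identity» as ONE kernel object, in the sense asked by s4-ref
  g39 VERDICT #8 §3 (`s4push/VERDICT-CORNER2-TWOSLOTGLUE-6c7656b5b7f70d1f-PREFILING-…-2026-08-25.md`).

Honest framing as in the companions: ring identities (theorems only, count-neutral, no `def`); the 2-adic READINGS
(`v₂(T₃) = 8 < 10` ⇒ CLASS-DEAD, the (V)-kills), LEMMA A(a)'s digit-space clause, LEMMA C and the tower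
bookkeeping stay pencil ∕ machine; this is bookkeeping for a CLASS-LEVEL necessary-condition sieve (CRITERION L) at
the special fibre `E⁶`; nothing here is an object, a `σ` computation or a Hodge statement, and nothing here bears
on HC ∕ HC_CM ∕ HC_AV.
-/

namespace Summit.Ventures.HSemireg.TwoSlotGlue

open TwoSlotFrameTable DegreeSixSecondDigit

section Frame

/-! ### 1. The identities on the h∕l-level frame (any commutative ring; table entries as hypotheses) -/

variable {R : Type*} [CommRing R]

/-- **LEMMA B on the h∕l-level frame.**  Hypotheses: the entries of the 2-vector table that are needed (squares of
the `hᵢ`, `h₀lⱼ = h₁lⱼ = 0`), the DEFINITIONS of the atoms `H, H₂, S₁, S₂, S₃`, of the cross-line part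
`L = a l₁ + b l₂ + c l₃ + d l₄` of the first digit and of its divided square `L₂ = (bc − ad)H₂`
(`TwoSlotFrameTable.crossLine_dividedSquare`), the closed forms `D₂, D₃, B₂, B₃, E₂, E₃`, the registered `T₃` at
`B = H + 2X + 4Y` (`X = S₁ + L + ηH`, `Y` arbitrary) and the σ-parametrisation.  Conclusion: `lemmaB`'s identity
with `λ = bc − ad`.  The atom relations `lemmaB` uses (`qH, zHH₂, qS₁₁, qS₁₂, zHL, zH₂L`) are DERIVED here from
`pairSum_sq ∕ pairSum_mul ∕ slotSum_11 ∕ slotSum_12 ∕ crossLine_h₀ ∕ crossLine_h₁` (s4-ref g38 VERDICT #4 §3 ∕ P-3;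
the referee's `refglue-lemmaB-hyps.lean` caae050686c42fb1 in the tree's vocabulary).  This is «atom table ⇒
identity» under the table entries as hypotheses; the table entries themselves are discharged in the exterior
algebra by `lemmaB_exterior` below.  The 2-adic reading stays pencil. -/
theorem lemmaB_frame (h₀ h₁ l₁ l₂ l₃ l₄ h₂ h₃ h₄ h₅ σ₀ σ₁ σ₂ σ₃ s t u η a b c d H H₂ S₁ S₂ S₃ L L₂ D
    D₂ D₃ B B₂ B₃ Y Y₂ Y₃ E₂ E₃ T₃' : R) (qh₀ : h₀ * h₀ = 0) (qh₁ : h₁ * h₁ = 0) (qh₂ : h₂ * h₂ = 0)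
    (qh₃ : h₃ * h₃ = 0) (qh₄ : h₄ * h₄ = 0) (qh₅ : h₅ * h₅ = 0) (zh₀l₁ : h₀ * l₁ = 0) (zh₀l₂ : h₀ *
    l₂ = 0) (zh₀l₃ : h₀ * l₃ = 0) (zh₀l₄ : h₀ * l₄ = 0) (zh₁l₁ : h₁ * l₁ = 0) (zh₁l₂ : h₁ * l₂ = 0)
    (zh₁l₃ : h₁ * l₃ = 0) (zh₁l₄ : h₁ * l₄ = 0) (hH : H = h₀ + h₁) (hH₂ : H₂ = h₀ * h₁) (hS₁ : S₁ =
    h₂ + h₃ + h₄ + h₅) (hS₂ : S₂ = h₂ * h₃ + h₂ * h₄ + h₂ * h₅ + h₃ * h₄ + h₃ * h₅ + h₄ * h₅) (hS₃ :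
    S₃ = h₂ * h₃ * h₄ + h₂ * h₃ * h₅ + h₂ * h₄ * h₅ + h₃ * h₄ * h₅) (hL : L = a * l₁ + b * l₂ + c *
    l₃ + d * l₄) (hL₂ : L₂ = (b * c - a * d) * H₂) (hD : D = 4 * H + 8 * S₁) (hD₂ : D₂ = 16 * H₂ +
    32 * (H * S₁) + 64 * S₂) (hD₃ : D₃ = 128 * (H₂ * S₁) + 256 * (H * S₂) + 512 * S₃) (hB : B = (1 +
    2 * η) * H + 2 * S₁ + 2 * L) (hB₂ : B₂ = (1 + 2 * η) ^ 2 * H₂ + 2 * (1 + 2 * η) * (H * (S₁ + L))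
    + 4 * (S₂ + S₁ * L + L₂)) (hB₃ : B₃ = 2 * (1 + 2 * η) ^ 2 * (H₂ * (S₁ + L)) + 4 * (1 + 2 * η) *
    (H * (S₂ + S₁ * L + L₂)) + 8 * (S₃ + S₂ * L + S₁ * L₂)) (hE₂ : E₂ = B₂ + 4 * (B * Y) + 16 * Y₂)
    (hE₃ : E₃ = B₃ + 4 * (B₂ * Y) + 16 * (B * Y₂) + 64 * Y₃) (hT₃' : T₃' = σ₃ * D₃ - 4 * σ₂ * (D₂ *
    (B + 4 * Y)) + 16 * σ₁ * (D * E₂) - 64 * σ₀ * E₃) (hσ₁ : σ₁ = 0) (hσ₂ : σ₂ = 4 * t - σ₀) (hσ₀ :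
    σ₀ = 2 * s + 1) (hσ₃ : σ₃ = 4 * u) :
    T₃' = 256 * (H₂ * S₁) + 512 * ((s + u - 3 * t - 4 * t * η - (1 + 2 * s) * (η ^ 2 + (b * c - a *
      d))) * (H₂ * S₁) + (1 + 2 * s + 2 * u - 6 * t - 4 * t * η) * (H * S₂) + (2 + 4 * s + 4 * u -
      12 * t) * S₃ - 4 * t * (L * S₂) - 2 * (Y * (((1 + 2 * s) * (η ^ 2 + η + (b * c - a * d)) + t)
      * H₂ + ((1 + 2 * s) * η + 2 * t) * (H * S₁) + 4 * t * S₂ + (1 + 2 * s) * (L * S₁))) - 2 * σ₀ *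
      (B * Y₂) - 8 * σ₀ * Y₃) := by
  have qH : H * H = 2 * H₂ := pairSum_sq h₀ h₁ H H₂ hH hH₂ qh₀ qh₁
  have zHH₂ : H * H₂ = 0 := pairSum_mul h₀ h₁ H H₂ hH hH₂ qh₀ qh₁
  have qS₁₁ : S₁ * S₁ = 2 * S₂ := slotSum_11 h₂ h₃ h₄ h₅ S₁ S₂ hS₁ hS₂ qh₂ qh₃ qh₄ qh₅
  have qS₁₂ : S₁ * S₂ = 3 * S₃ := slotSum_12 h₂ h₃ h₄ h₅ S₁ S₂ S₃ hS₁ hS₂ hS₃ qh₂ qh₃ qh₄ qh₅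
  have e₀ : h₀ * L = 0 := crossLine_h₀ h₀ l₁ l₂ l₃ l₄ a b c d L hL zh₀l₁ zh₀l₂ zh₀l₃ zh₀l₄
  have e₁ : h₁ * L = 0 := crossLine_h₁ h₁ l₁ l₂ l₃ l₄ a b c d L hL zh₁l₁ zh₁l₂ zh₁l₃ zh₁l₄
  have zHL : H * L = 0 := by linear_combination e₀ + e₁ + L * hH
  have zH₂L : H₂ * L = 0 := by linear_combination h₁ * e₀ + L * hH₂
  exact lemmaB σ₀ σ₁ σ₂ σ₃ s t u η (b * c - a * d) H H₂ S₁ S₂ S₃ L L₂ D D₂ D₃ B B₂ B₃ Y Y₂ Y₃ E₂ E₃ T₃' hT₃'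
    hE₂ hE₃ hD hD₂ hD₃ hB hB₂ hB₃ qH zHH₂ qS₁₁ qS₁₂ zHL zH₂L hL₂ hσ₁ hσ₂ hσ₀ hσ₃

/-! ### Glue: LEMMA A(a), inconsistent direction, on the h∕l-level frame — any cross-line functional -/

/-- **LEMMA A(a), inconsistent direction, on the frame (glue) — every cross-line functional at once.**  Leading
digit `C = β₀₁h₀ + β₂₃h₁ + N` with cross-line part `N = n₁l₁ + ⋯ + n₄l₄`; functional part `F = c₁l₁ + ⋯ + c₄l₄`
(ANY coefficients: `F = 0` and `F = lⱼ` are the memo's five cases), `ϖ := c₂n₃ + c₃n₂ − c₁n₄ − c₄n₁` its pairing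
with `N` (so `F·N = ϖ·h₀h₁`, assembled from `TwoSlotFrameTable.crossLine_pair₁…₄`), parity clause `β₂₃ + ϖ = 2m`.
Hypotheses: the table entries needed (`h₀² = h₃² = h₄² = h₅² = 0`, `lⱼ² = 0`, `hᵢlⱼ = 0`, `l₁l₂ = l₁l₃ = l₂l₄ =
l₃l₄ = 0`, `l₁l₄ = −h₀h₁`, `l₂l₃ = h₀h₁`) and the definitions; `DegreeSixSecondDigit.obstruction`'s hypotheses
`zh₀N, zh₀F, zh₁F, hFN, hS₁G` are DERIVED (`crossLine_h₀ ∕ h₁ ∕ pairⱼ`, `slotSum_G` with `G = h₃h₄h₅`): any solution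
`X` of the digit equation `pH₂ − HS₁ + CX = 2W` forces the top class `H₂S₄` into `2R`. -/
theorem obstruction_frame (h₀ h₁ l₁ l₂ l₃ l₄ h₂ h₃ h₄ h₅ p m ϖ n₁ n₂ n₃ n₄ c₁ c₂ c₃ c₄ β₀₁ β₂₃ H H₂ S₁
    S₄ G N F C X W : R) (qh₀ : h₀ * h₀ = 0) (qh₃ : h₃ * h₃ = 0) (qh₄ : h₄ * h₄ = 0) (qh₅ : h₅ * h₅ = 0)
    (ql₁ : l₁ * l₁ = 0) (ql₂ : l₂ * l₂ = 0) (ql₃ : l₃ * l₃ = 0) (ql₄ : l₄ * l₄ = 0) (zh₀l₁ : h₀ * l₁ = 0)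
    (zh₀l₂ : h₀ * l₂ = 0) (zh₀l₃ : h₀ * l₃ = 0) (zh₀l₄ : h₀ * l₄ = 0) (zh₁l₁ : h₁ * l₁ = 0)
    (zh₁l₂ : h₁ * l₂ = 0) (zh₁l₃ : h₁ * l₃ = 0) (zh₁l₄ : h₁ * l₄ = 0) (zl₁l₂ : l₁ * l₂ = 0)
    (zl₁l₃ : l₁ * l₃ = 0) (zl₂l₄ : l₂ * l₄ = 0) (zl₃l₄ : l₃ * l₄ = 0) (pl₁l₄ : l₁ * l₄ = -(h₀ * h₁))
    (pl₂l₃ : l₂ * l₃ = h₀ * h₁) (hH : H = h₀ + h₁) (hH₂ : H₂ = h₀ * h₁) (hS₁ : S₁ = h₂ + h₃ + h₄ + h₅)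
    (hS₄ : S₄ = h₂ * h₃ * h₄ * h₅) (hG : G = h₃ * h₄ * h₅) (hN : N = n₁ * l₁ + n₂ * l₂ + n₃ * l₃ + n₄ * l₄)
    (hF : F = c₁ * l₁ + c₂ * l₂ + c₃ * l₃ + c₄ * l₄) (hϖ : ϖ = c₂ * n₃ + c₃ * n₂ - c₁ * n₄ - c₄ * n₁)
    (hC : C = β₀₁ * h₀ + β₂₃ * h₁ + N) (hX : p * H₂ - H * S₁ + C * X = 2 * W) (hm : β₂₃ + ϖ = 2 * m) :
    H₂ * S₄ = 2 * (m * (H₂ * (X * G)) - (h₀ + F) * (G * W)) := by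
  have zh₀N : h₀ * N = 0 := crossLine_h₀ h₀ l₁ l₂ l₃ l₄ n₁ n₂ n₃ n₄ N hN zh₀l₁ zh₀l₂ zh₀l₃ zh₀l₄
  have zh₀F : h₀ * F = 0 := crossLine_h₀ h₀ l₁ l₂ l₃ l₄ c₁ c₂ c₃ c₄ F hF zh₀l₁ zh₀l₂ zh₀l₃ zh₀l₄
  have zh₁F : h₁ * F = 0 := crossLine_h₁ h₁ l₁ l₂ l₃ l₄ c₁ c₂ c₃ c₄ F hF zh₁l₁ zh₁l₂ zh₁l₃ zh₁l₄
  have e₁ := crossLine_pair₁ h₀ h₁ l₁ l₂ l₃ l₄ n₁ n₂ n₃ n₄ N hN ql₁ zl₁l₂ zl₁l₃ pl₁l₄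
  have e₂ := crossLine_pair₂ h₀ h₁ l₁ l₂ l₃ l₄ n₁ n₂ n₃ n₄ N hN ql₂ zl₁l₂ zl₂l₄ pl₂l₃
  have e₃ := crossLine_pair₃ h₀ h₁ l₁ l₂ l₃ l₄ n₁ n₂ n₃ n₄ N hN ql₃ zl₁l₃ zl₃l₄ pl₂l₃
  have e₄ := crossLine_pair₄ h₀ h₁ l₁ l₂ l₃ l₄ n₁ n₂ n₃ n₄ N hN ql₄ zl₂l₄ zl₃l₄ pl₁l₄
  have hFN : F * N = ϖ * (h₀ * h₁) := by
    rw [hF, hϖ]; linear_combination c₁ * e₁ + c₂ * e₂ + c₃ * e₃ + c₄ * e₄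
  have hS₁G : S₁ * G = S₄ := slotSum_G h₂ h₃ h₄ h₅ S₁ S₄ G hG hS₁ hS₄ qh₃ qh₄ qh₅
  exact obstruction h₀ h₁ p m ϖ β₀₁ β₂₃ H H₂ S₁ S₄ G N F C X W hC hH hH₂ qh₀ zh₀N zh₀F zh₁F hFN hS₁G hX hm

/-! ### Glue: LEMMA D(b) on the h-level frame (one representative type) -/

/-- **LEMMA D(b) on the frame (glue), type `(2,2,2,2,3,5)`.**  With the clique sums DEFINED from the slots
(`P₁ = h₀ + h₁ + h₂ + h₃`, `P₂`, `P₃` their elementary symmetric square ∕ cube) and `hᵢ² = 0`, the clique-sum law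
`P₁P₁ = 2P₂`, `P₁P₂ = 3P₃` is `TwoSlotFrameTable.slotSum_11 ∕ _12` (instantiated at `h₀, …, h₃`), and
`CliqueUnitKills.T3_Km2235` applies: the identity for `T₃(P₁)` follows from the table, the closed forms and the
σ-parametrisation alone.  The other six types compose identically (with `cliqueSum_*` for 3 ∕ 5 ∕ 6 slots). -/
theorem T3_Km2235_frame (h₀ h₁ h₂ h₃ h₄ h₅ σ₀ σ₁ σ₂ σ₃ s t u P₁ P₂ P₃ D D₂ D₃ T₃ : R) (qh₀ : h₀ * h₀
    = 0) (qh₁ : h₁ * h₁ = 0) (qh₂ : h₂ * h₂ = 0) (qh₃ : h₃ * h₃ = 0) (hP₁ : P₁ = h₀ + h₁ + h₂ + h₃)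
    (hP₂ : P₂ = h₀ * h₁ + h₀ * h₂ + h₀ * h₃ + h₁ * h₂ + h₁ * h₃ + h₂ * h₃) (hP₃ : P₃ = h₀ * h₁ * h₂
    + h₀ * h₁ * h₃ + h₀ * h₂ * h₃ + h₁ * h₂ * h₃) (hT₃ : T₃ = σ₃ * D₃ - 4 * σ₂ * (D₂ * P₁) + 16 * σ₁
    * (D * P₂) - 64 * σ₀ * P₃) (hD : D = 4 * P₁ + 8 * h₄ + 32 * h₅) (hD₂ : D₂ = (256) * h₄ * h₅ +
    (128) * P₁ * h₅ + (32) * P₁ * h₄ + (16) * P₂) (hD₃ : D₃ = (1024) * P₁ * h₄ * h₅ + (512) * P₂ *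
    h₅ + (128) * P₂ * h₄ + (64) * P₃) (hσ₁ : σ₁ = 0) (hσ₂ : σ₂ = 4 * t - σ₀) (hσ₀ : σ₀ = 2 * s + 1)
    (hσ₃ : σ₃ = 4 * u) :
    T₃ = 128 * ((2 * s + 2 * u + 1 - 6 * t) * P₃) + 256 * ((4) * P₁ * h₄ * h₅ + (16) * P₁ * h₄ * h₅
      * u + (-16) * P₁ * h₄ * h₅ * t + (8) * P₁ * h₄ * h₅ * s + (4) * P₂ * h₅ + (8) * P₂ * h₅ * u +
      (-16) * P₂ * h₅ * t + (8) * P₂ * h₅ * s + P₂ * h₄ + (2) * P₂ * h₄ * u + (-4) * P₂ * h₄ * t +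
      (2) * P₂ * h₄ * s) := by
  have qP₁₁ : P₁ * P₁ = 2 * P₂ := TwoSlotFrameTable.slotSum_11 h₀ h₁ h₂ h₃ P₁ P₂ hP₁ hP₂ qh₀ qh₁ qh₂ qh₃
  have qP₁₂ : P₁ * P₂ = 3 * P₃ := TwoSlotFrameTable.slotSum_12 h₀ h₁ h₂ h₃ P₁ P₂ P₃ hP₁ hP₂ hP₃ qh₀ qh₁ qh₂ qh₃
  exact CliqueUnitKills.T3_Km2235 h₄ h₅ σ₀ σ₁ σ₂ σ₃ s t u P₁ P₂ P₃ D D₂ D₃ T₃ hT₃ hD hD₂ hD₃ qP₁₁ qP₁₂ hσ₁ hσ₂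
    hσ₀ hσ₃


end Frame

section Exterior

/-! ### 2. The join: the same identities for the actual 2-vectors in Mathlib's `ExteriorAlgebra R M` -/

open ExteriorAlgebra (ι)
open scoped IsMulCommutative

variable {R : Type*} [CommRing R] {M : Type*} [AddCommGroup M] [Module R M]

/-- 2-vectors `ι x · ι y` pairwise commute (`TwoSlotFrameTable.twoVector_comm`), stated on the generating set
`{ι x · ι y}` in the form `Algebra.isMulCommutative_adjoin` wants. -/
theorem twoVector_range_comm :
    ∀ z ∈ Set.range (fun p : M × M => ι R p.1 * ι R p.2),
      ∀ w ∈ Set.range (fun p : M × M => ι R p.1 * ι R p.2), z * w = w * z := by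
  rintro _ ⟨⟨u, v⟩, rfl⟩ _ ⟨⟨u', v'⟩, rfl⟩
  exact twoVector_comm u v u' v'

/-- **The 2-vector subalgebra is commutative.**  `Λ := Algebra.adjoin R {ι x · ι y : x, y ∈ M}` — the
subalgebra of `ExteriorAlgebra R M` generated by the 2-vectors, i.e. the even part `⊕ₖ Λ^{2k} M` — satisfies
`IsMulCommutative Λ` (Mathlib's `Algebra.isMulCommutative_adjoin`); inside `open scoped IsMulCommutative` it is
therefore a `CommRing`, which is the commutative ring «`Λ^{ev}`» in which the `Frame` identities are instantiated. -/
theorem isMulCommutative_twoVectorSubalgebra :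
    IsMulCommutative (Algebra.adjoin R (Set.range fun p : M × M => ι R p.1 * ι R p.2)) :=
  Algebra.isMulCommutative_adjoin R twoVector_range_comm

/-- **The 2-vector subalgebra is the even part.**  `Algebra.adjoin R {ι x · ι y} = CliffordAlgebra.even 0`, the
even subalgebra `⊕ₖ Λ^{2k}M` of Mathlib's `ℤ/2`-grading `CliffordAlgebra.evenOdd` (recall `ExteriorAlgebra R M` is
`CliffordAlgebra (0 : QuadraticForm R M)`).  `≤`: a 2-vector is even (`CliffordAlgebra.ι_mul_ι_mem_evenOdd_zero`);
`≥`: Mathlib's `CliffordAlgebra.even_induction` (even elements are generated from scalars by sums and left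
multiplication by pairs `ι m₁ ι m₂`).  So the membership hypotheses `· ∈ Λ` of the theorems below say exactly
«is an even element», e.g. `Y ∈ Λ^{ev}ℤ¹²` in the application. -/
theorem twoVectorSubalgebra_eq_even :
    Algebra.adjoin R (Set.range fun p : M × M => ι R p.1 * ι R p.2)
      = CliffordAlgebra.even (0 : QuadraticForm R M) := by
  apply le_antisymm
  · refine Algebra.adjoin_le ?_
    rintro _ ⟨⟨u, v⟩, rfl⟩
    exact CliffordAlgebra.ι_mul_ι_mem_evenOdd_zero _ u v
  · intro x hx
    change x ∈ CliffordAlgebra.evenOdd _ 0 at hx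
    induction x, hx using CliffordAlgebra.even_induction with
    | algebraMap r => exact Subalgebra.algebraMap_mem _ r
    | add x y hx hy ihx ihy => exact Subalgebra.add_mem _ ihx ihy
    | ι_mul_ι_mul m₁ m₂ x hx ih =>
      exact Subalgebra.mul_mem _ (Algebra.subset_adjoin ⟨(m₁, m₂), rfl⟩) ih

/-- **LEMMA B in the exterior algebra (the join).**  For ANY commutative ring `R`, module `M` and twelve vectors
`x₀, …, x₁₁ : M` (slot `i` = `⟨x_{2i}, x_{2i+1}⟩`), put `h₀ = ι x₀ ι x₁`, `h₁ = ι x₂ ι x₃`, the cross lines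
`l₁ = ι x₀ ι x₂, l₂ = ι x₀ ι x₃, l₃ = ι x₁ ι x₂, l₄ = ι x₁ ι x₃`, and `h₂, …, h₅` the outer slots.  Let the
parameters `s, t, u, η, a, b, c, d` and `Y, Y₂, Y₃` be ANY elements of the 2-vector (= even, by
`twoVectorSubalgebra_eq_even`) subalgebra `Λ` — e.g. integers or scalars (in `Λ` by `intCast_mem` ∕
`Subalgebra.algebraMap_mem`) and an even `Y` with its divided powers.  Then, with the atoms, closed forms, `T₃`
and σ's DEFINED as in
`lemmaB_frame` (these hypotheses are abbreviations, each dischargeable by `rfl`), `lemmaB`'s identity holds in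
`ExteriorAlgebra R M` — with NO multiplication-table entry among the hypotheses: `hᵢ² = 0` and `h₀lⱼ = h₁lⱼ = 0`
are `TwoSlotFrameTable.twoVector_mul_self ∕ table_zero_*`, used inside the proof in the commutative ring `Λ`
(`isMulCommutative_twoVectorSubalgebra`), where `lemmaB_frame` is instantiated and then pushed through the
injection `Λ → ExteriorAlgebra R M`.  The 2-adic reading (`T₃ ≡ 2⁸h₀h₁S₁ mod 2⁹`, so `v₂ = 8 < 10`) stays pencil. -/
theorem lemmaB_exterior (x₀ x₁ x₂ x₃ x₄ x₅ x₆ x₇ x₈ x₉ x₁₀ x₁₁ : M)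
    (Λ : Subalgebra R (ExteriorAlgebra R M)) (h₀ h₁ l₁ l₂ l₃ l₄ h₂ h₃ h₄ h₅ σ₀ σ₁ σ₂ σ₃ s t u η a b
    c d H H₂ S₁ S₂ S₃ L L₂ D D₂ D₃ B B₂ B₃ Y Y₂ Y₃ E₂ E₃ T₃' : ExteriorAlgebra R M)
    (hΛ : Λ = Algebra.adjoin R (Set.range fun p : M × M => ι R p.1 * ι R p.2))
    (hh₀ : h₀ = ι R x₀ * ι R x₁) (hh₁ : h₁ = ι R x₂ * ι R x₃) (hl₁ : l₁ = ι R x₀ * ι R x₂)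
    (hl₂ : l₂ = ι R x₀ * ι R x₃) (hl₃ : l₃ = ι R x₁ * ι R x₂) (hl₄ : l₄ = ι R x₁ * ι R x₃)
    (hh₂ : h₂ = ι R x₄ * ι R x₅) (hh₃ : h₃ = ι R x₆ * ι R x₇) (hh₄ : h₄ = ι R x₈ * ι R x₉)
    (hh₅ : h₅ = ι R x₁₀ * ι R x₁₁) (ms : s ∈ Λ) (mt : t ∈ Λ) (mu : u ∈ Λ) (mη : η ∈ Λ) (ma : a ∈ Λ)
    (mb : b ∈ Λ) (mc : c ∈ Λ) (md : d ∈ Λ) (mY : Y ∈ Λ) (mY₂ : Y₂ ∈ Λ) (mY₃ : Y₃ ∈ Λ)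
    (hH : H = h₀ + h₁) (hH₂ : H₂ = h₀ * h₁) (hS₁ : S₁ = h₂ + h₃ + h₄ + h₅)
    (hS₂ : S₂ = h₂ * h₃ + h₂ * h₄ + h₂ * h₅ + h₃ * h₄ + h₃ * h₅ + h₄ * h₅)
    (hS₃ : S₃ = h₂ * h₃ * h₄ + h₂ * h₃ * h₅ + h₂ * h₄ * h₅ + h₃ * h₄ * h₅)
    (hL : L = a * l₁ + b * l₂ + c * l₃ + d * l₄) (hL₂ : L₂ = (b * c - a * d) * H₂)
    (hD : D = 4 * H + 8 * S₁) (hD₂ : D₂ = 16 * H₂ + 32 * (H * S₁) + 64 * S₂)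
    (hD₃ : D₃ = 128 * (H₂ * S₁) + 256 * (H * S₂) + 512 * S₃)
    (hB : B = (1 + 2 * η) * H + 2 * S₁ + 2 * L)
    (hB₂ : B₂ = (1 + 2 * η) ^ 2 * H₂ + 2 * (1 + 2 * η) * (H * (S₁ + L)) + 4 * (S₂ + S₁ * L + L₂))
    (hB₃ : B₃ = 2 * (1 + 2 * η) ^ 2 * (H₂ * (S₁ + L)) + 4 * (1 + 2 * η) * (H * (S₂ + S₁ * L + L₂))
      + 8 * (S₃ + S₂ * L + S₁ * L₂))
    (hE₂ : E₂ = B₂ + 4 * (B * Y) + 16 * Y₂) (hE₃ : E₃ = B₃ + 4 * (B₂ * Y) + 16 * (B * Y₂) + 64 * Y₃)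
    (hT₃' : T₃' = σ₃ * D₃ - 4 * σ₂ * (D₂ * (B + 4 * Y)) + 16 * σ₁ * (D * E₂) - 64 * σ₀ * E₃)
    (hσ₁ : σ₁ = 0) (hσ₂ : σ₂ = 4 * t - σ₀) (hσ₀ : σ₀ = 2 * s + 1) (hσ₃ : σ₃ = 4 * u) :
    T₃' = 256 * (H₂ * S₁) + 512 * ((s + u - 3 * t - 4 * t * η - (1 + 2 * s) * (η ^ 2 + (b * c - a *
      d))) * (H₂ * S₁) + (1 + 2 * s + 2 * u - 6 * t - 4 * t * η) * (H * S₂) + (2 + 4 * s + 4 * u -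
      12 * t) * S₃ - 4 * t * (L * S₂) - 2 * (Y * (((1 + 2 * s) * (η ^ 2 + η + (b * c - a * d)) + t)
      * H₂ + ((1 + 2 * s) * η + 2 * t) * (H * S₁) + 4 * t * S₂ + (1 + 2 * s) * (L * S₁))) - 2 * σ₀ *
      (B * Y₂) - 8 * σ₀ * Y₃) := by
  subst hΛ
  haveI := isMulCommutative_twoVectorSubalgebra (R := R) (M := M)
  set Λ := Algebra.adjoin R (Set.range fun p : M × M => ι R p.1 * ι R p.2)
  have mh₀ : h₀ ∈ Λ := Algebra.subset_adjoin ⟨(x₀, x₁), hh₀.symm⟩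
  have mh₁ : h₁ ∈ Λ := Algebra.subset_adjoin ⟨(x₂, x₃), hh₁.symm⟩
  have ml₁ : l₁ ∈ Λ := Algebra.subset_adjoin ⟨(x₀, x₂), hl₁.symm⟩
  have ml₂ : l₂ ∈ Λ := Algebra.subset_adjoin ⟨(x₀, x₃), hl₂.symm⟩
  have ml₃ : l₃ ∈ Λ := Algebra.subset_adjoin ⟨(x₁, x₂), hl₃.symm⟩
  have ml₄ : l₄ ∈ Λ := Algebra.subset_adjoin ⟨(x₁, x₃), hl₄.symm⟩
  have mh₂ : h₂ ∈ Λ := Algebra.subset_adjoin ⟨(x₄, x₅), hh₂.symm⟩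
  have mh₃ : h₃ ∈ Λ := Algebra.subset_adjoin ⟨(x₆, x₇), hh₃.symm⟩
  have mh₄ : h₄ ∈ Λ := Algebra.subset_adjoin ⟨(x₈, x₉), hh₄.symm⟩
  have mh₅ : h₅ ∈ Λ := Algebra.subset_adjoin ⟨(x₁₀, x₁₁), hh₅.symm⟩
  -- the table entries, as equations in the commutative ring Λ, from the exterior algebra
  have qh₀ : (⟨h₀, mh₀⟩ : Λ) * ⟨h₀, mh₀⟩ = 0 := Subtype.ext (by subst hh₀; exact twoVector_mul_self x₀ x₁)
  have qh₁ : (⟨h₁, mh₁⟩ : Λ) * ⟨h₁, mh₁⟩ = 0 := Subtype.ext (by subst hh₁; exact twoVector_mul_self x₂ x₃)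
  have qh₂ : (⟨h₂, mh₂⟩ : Λ) * ⟨h₂, mh₂⟩ = 0 := Subtype.ext (by subst hh₂; exact twoVector_mul_self x₄ x₅)
  have qh₃ : (⟨h₃, mh₃⟩ : Λ) * ⟨h₃, mh₃⟩ = 0 := Subtype.ext (by subst hh₃; exact twoVector_mul_self x₆ x₇)
  have qh₄ : (⟨h₄, mh₄⟩ : Λ) * ⟨h₄, mh₄⟩ = 0 := Subtype.ext (by subst hh₄; exact twoVector_mul_self x₈ x₉)
  have qh₅ : (⟨h₅, mh₅⟩ : Λ) * ⟨h₅, mh₅⟩ = 0 :=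
    Subtype.ext (by subst hh₅; exact twoVector_mul_self x₁₀ x₁₁)
  have zh₀l₁ : (⟨h₀, mh₀⟩ : Λ) * ⟨l₁, ml₁⟩ = 0 := Subtype.ext (by subst hh₀ hl₁; exact table_zero_ff x₀ x₁ x₂)
  have zh₀l₂ : (⟨h₀, mh₀⟩ : Λ) * ⟨l₂, ml₂⟩ = 0 := Subtype.ext (by subst hh₀ hl₂; exact table_zero_ff x₀ x₁ x₃)
  have zh₀l₃ : (⟨h₀, mh₀⟩ : Λ) * ⟨l₃, ml₃⟩ = 0 := Subtype.ext (by subst hh₀ hl₃; exact table_zero_st x₀ x₁ x₂)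
  have zh₀l₄ : (⟨h₀, mh₀⟩ : Λ) * ⟨l₄, ml₄⟩ = 0 := Subtype.ext (by subst hh₀ hl₄; exact table_zero_st x₀ x₁ x₃)
  have zh₁l₁ : (⟨h₁, mh₁⟩ : Λ) * ⟨l₁, ml₁⟩ = 0 := Subtype.ext (by subst hh₁ hl₁; exact table_zero_fl x₂ x₃ x₀)
  have zh₁l₂ : (⟨h₁, mh₁⟩ : Λ) * ⟨l₂, ml₂⟩ = 0 := Subtype.ext (by subst hh₁ hl₂; exact table_zero_sl x₂ x₃ x₀)
  have zh₁l₃ : (⟨h₁, mh₁⟩ : Λ) * ⟨l₃, ml₃⟩ = 0 := Subtype.ext (by subst hh₁ hl₃; exact table_zero_fl x₂ x₃ x₁)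
  have zh₁l₄ : (⟨h₁, mh₁⟩ : Λ) * ⟨l₄, ml₄⟩ = 0 := Subtype.ext (by subst hh₁ hl₄; exact table_zero_sl x₂ x₃ x₁)
  subst hH hH₂ hS₁ hS₂ hS₃ hL hL₂ hD hD₂ hD₃ hB hB₂ hB₃ hE₂ hE₃ hT₃' hσ₁ hσ₂ hσ₀ hσ₃
  -- `lemmaB_frame` in the commutative ring Λ (atoms := their definitions, table entries := the facts above)
  have key := congrArg Subtype.val
    (lemmaB_frame (R := Λ) ⟨h₀, mh₀⟩ ⟨h₁, mh₁⟩ ⟨l₁, ml₁⟩ ⟨l₂, ml₂⟩ ⟨l₃, ml₃⟩ ⟨l₄, ml₄⟩ ⟨h₂, mh₂⟩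
      ⟨h₃, mh₃⟩ ⟨h₄, mh₄⟩ ⟨h₅, mh₅⟩ _ _ _ _ ⟨s, ms⟩ ⟨t, mt⟩ ⟨u, mu⟩ ⟨η, mη⟩ ⟨a, ma⟩ ⟨b, mb⟩ ⟨c, mc⟩
      ⟨d, md⟩ _ _ _ _ _ _ _ _ _ _ _ _ _ ⟨Y, mY⟩ ⟨Y₂, mY₂⟩ ⟨Y₃, mY₃⟩ _ _ _ qh₀ qh₁ qh₂ qh₃ qh₄ qh₅ zh₀l₁
      zh₀l₂ zh₀l₃ zh₀l₄ zh₁l₁ zh₁l₂ zh₁l₃ zh₁l₄ rfl rfl rfl rfl rfl rfl rfl rfl rfl rfl rfl rfl rfl rfl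
      rfl rfl rfl rfl rfl rfl)
  push_cast at key ⊢
  exact key

/-- **LEMMA A(a), inconsistent direction, in the exterior algebra (the join) — every cross-line functional at
once.**  Same frame as `lemmaB_exterior`; the leading digit `C = β₀₁h₀ + β₂₃h₁ + N` (`N = n₁l₁ + ⋯ + n₄l₄`), the
functional part `F = c₁l₁ + ⋯ + c₄l₄` (any coefficients — the memo's cases `F = 0, l₁, l₂, l₃, l₄` and every
combination), its pairing `ϖ = c₂n₃ + c₃n₂ − c₁n₄ − c₄n₁` with `N`, the digit-equation data `p, X, W` and `m` with
`β₂₃ + ϖ = 2m` range over ANY elements of the 2-vector (= even) subalgebra `Λ`; premises: the digit equation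
`pH₂ − HS₁ + CX = 2W` and the parity clause, as the memo prints them.  Conclusion: `obstruction`'s identity in
`ExteriorAlgebra R M` — the top class `H₂S₄ = h₀h₁h₂h₃h₄h₅` lies in `2·(…)` — with NO table entry among the
hypotheses (all 22 needed entries are `TwoSlotFrameTable.twoVector_mul_self ∕ table_zero_* ∕ table_signed`, used in
`Λ`).  The reading «impossible over ℤ, so no first digit exists» and the coverage «such an `F` with `β₂₃ + ϖ` even
exists for 15 of the 16 leading digits» stay pencil. -/
theorem obstruction_exterior (x₀ x₁ x₂ x₃ x₄ x₅ x₆ x₇ x₈ x₉ x₁₀ x₁₁ : M)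
    (Λ : Subalgebra R (ExteriorAlgebra R M)) (h₀ h₁ l₁ l₂ l₃ l₄ h₂ h₃ h₄ h₅ p m ϖ n₁ n₂ n₃ n₄ c₁ c₂ c₃
    c₄ β₀₁ β₂₃ H H₂ S₁ S₄ G N F C X W : ExteriorAlgebra R M)
    (hΛ : Λ = Algebra.adjoin R (Set.range fun p : M × M => ι R p.1 * ι R p.2))
    (hh₀ : h₀ = ι R x₀ * ι R x₁) (hh₁ : h₁ = ι R x₂ * ι R x₃) (hl₁ : l₁ = ι R x₀ * ι R x₂)
    (hl₂ : l₂ = ι R x₀ * ι R x₃) (hl₃ : l₃ = ι R x₁ * ι R x₂) (hl₄ : l₄ = ι R x₁ * ι R x₃)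
    (hh₂ : h₂ = ι R x₄ * ι R x₅) (hh₃ : h₃ = ι R x₆ * ι R x₇) (hh₄ : h₄ = ι R x₈ * ι R x₉)
    (hh₅ : h₅ = ι R x₁₀ * ι R x₁₁) (mp : p ∈ Λ) (mm : m ∈ Λ) (mn₁ : n₁ ∈ Λ) (mn₂ : n₂ ∈ Λ)
    (mn₃ : n₃ ∈ Λ) (mn₄ : n₄ ∈ Λ) (mc₁ : c₁ ∈ Λ) (mc₂ : c₂ ∈ Λ) (mc₃ : c₃ ∈ Λ) (mc₄ : c₄ ∈ Λ)
    (mβ₀₁ : β₀₁ ∈ Λ) (mβ₂₃ : β₂₃ ∈ Λ) (mX : X ∈ Λ) (mW : W ∈ Λ)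
    (hH : H = h₀ + h₁) (hH₂ : H₂ = h₀ * h₁) (hS₁ : S₁ = h₂ + h₃ + h₄ + h₅)
    (hS₄ : S₄ = h₂ * h₃ * h₄ * h₅) (hG : G = h₃ * h₄ * h₅)
    (hN : N = n₁ * l₁ + n₂ * l₂ + n₃ * l₃ + n₄ * l₄) (hF : F = c₁ * l₁ + c₂ * l₂ + c₃ * l₃ + c₄ * l₄)
    (hϖ : ϖ = c₂ * n₃ + c₃ * n₂ - c₁ * n₄ - c₄ * n₁) (hC : C = β₀₁ * h₀ + β₂₃ * h₁ + N)
    (hX : p * H₂ - H * S₁ + C * X = 2 * W) (hm : β₂₃ + ϖ = 2 * m) :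
    H₂ * S₄ = 2 * (m * (H₂ * (X * G)) - (h₀ + F) * (G * W)) := by
  subst hΛ
  haveI := isMulCommutative_twoVectorSubalgebra (R := R) (M := M)
  set Λ := Algebra.adjoin R (Set.range fun p : M × M => ι R p.1 * ι R p.2)
  have mh₀ : h₀ ∈ Λ := Algebra.subset_adjoin ⟨(x₀, x₁), hh₀.symm⟩
  have mh₁ : h₁ ∈ Λ := Algebra.subset_adjoin ⟨(x₂, x₃), hh₁.symm⟩
  have ml₁ : l₁ ∈ Λ := Algebra.subset_adjoin ⟨(x₀, x₂), hl₁.symm⟩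
  have ml₂ : l₂ ∈ Λ := Algebra.subset_adjoin ⟨(x₀, x₃), hl₂.symm⟩
  have ml₃ : l₃ ∈ Λ := Algebra.subset_adjoin ⟨(x₁, x₂), hl₃.symm⟩
  have ml₄ : l₄ ∈ Λ := Algebra.subset_adjoin ⟨(x₁, x₃), hl₄.symm⟩
  have mh₂ : h₂ ∈ Λ := Algebra.subset_adjoin ⟨(x₄, x₅), hh₂.symm⟩
  have mh₃ : h₃ ∈ Λ := Algebra.subset_adjoin ⟨(x₆, x₇), hh₃.symm⟩
  have mh₄ : h₄ ∈ Λ := Algebra.subset_adjoin ⟨(x₈, x₉), hh₄.symm⟩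
  have mh₅ : h₅ ∈ Λ := Algebra.subset_adjoin ⟨(x₁₀, x₁₁), hh₅.symm⟩
  -- the 22 table entries, as equations in Λ, from the exterior algebra
  have qh₀ : (⟨h₀, mh₀⟩ : Λ) * ⟨h₀, mh₀⟩ = 0 := Subtype.ext (by subst hh₀; exact twoVector_mul_self x₀ x₁)
  have qh₃ : (⟨h₃, mh₃⟩ : Λ) * ⟨h₃, mh₃⟩ = 0 := Subtype.ext (by subst hh₃; exact twoVector_mul_self x₆ x₇)
  have qh₄ : (⟨h₄, mh₄⟩ : Λ) * ⟨h₄, mh₄⟩ = 0 := Subtype.ext (by subst hh₄; exact twoVector_mul_self x₈ x₉)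
  have qh₅ : (⟨h₅, mh₅⟩ : Λ) * ⟨h₅, mh₅⟩ = 0 :=
    Subtype.ext (by subst hh₅; exact twoVector_mul_self x₁₀ x₁₁)
  have ql₁ : (⟨l₁, ml₁⟩ : Λ) * ⟨l₁, ml₁⟩ = 0 := Subtype.ext (by subst hl₁; exact twoVector_mul_self x₀ x₂)
  have ql₂ : (⟨l₂, ml₂⟩ : Λ) * ⟨l₂, ml₂⟩ = 0 := Subtype.ext (by subst hl₂; exact twoVector_mul_self x₀ x₃)
  have ql₃ : (⟨l₃, ml₃⟩ : Λ) * ⟨l₃, ml₃⟩ = 0 := Subtype.ext (by subst hl₃; exact twoVector_mul_self x₁ x₂)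
  have ql₄ : (⟨l₄, ml₄⟩ : Λ) * ⟨l₄, ml₄⟩ = 0 := Subtype.ext (by subst hl₄; exact twoVector_mul_self x₁ x₃)
  have zh₀l₁ : (⟨h₀, mh₀⟩ : Λ) * ⟨l₁, ml₁⟩ = 0 := Subtype.ext (by subst hh₀ hl₁; exact table_zero_ff x₀ x₁ x₂)
  have zh₀l₂ : (⟨h₀, mh₀⟩ : Λ) * ⟨l₂, ml₂⟩ = 0 := Subtype.ext (by subst hh₀ hl₂; exact table_zero_ff x₀ x₁ x₃)
  have zh₀l₃ : (⟨h₀, mh₀⟩ : Λ) * ⟨l₃, ml₃⟩ = 0 := Subtype.ext (by subst hh₀ hl₃; exact table_zero_st x₀ x₁ x₂)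
  have zh₀l₄ : (⟨h₀, mh₀⟩ : Λ) * ⟨l₄, ml₄⟩ = 0 := Subtype.ext (by subst hh₀ hl₄; exact table_zero_st x₀ x₁ x₃)
  have zh₁l₁ : (⟨h₁, mh₁⟩ : Λ) * ⟨l₁, ml₁⟩ = 0 := Subtype.ext (by subst hh₁ hl₁; exact table_zero_fl x₂ x₃ x₀)
  have zh₁l₂ : (⟨h₁, mh₁⟩ : Λ) * ⟨l₂, ml₂⟩ = 0 := Subtype.ext (by subst hh₁ hl₂; exact table_zero_sl x₂ x₃ x₀)
  have zh₁l₃ : (⟨h₁, mh₁⟩ : Λ) * ⟨l₃, ml₃⟩ = 0 := Subtype.ext (by subst hh₁ hl₃; exact table_zero_fl x₂ x₃ x₁)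
  have zh₁l₄ : (⟨h₁, mh₁⟩ : Λ) * ⟨l₄, ml₄⟩ = 0 := Subtype.ext (by subst hh₁ hl₄; exact table_zero_sl x₂ x₃ x₁)
  have zl₁l₂ : (⟨l₁, ml₁⟩ : Λ) * ⟨l₂, ml₂⟩ = 0 := Subtype.ext (by subst hl₁ hl₂; exact table_zero_ff x₀ x₂ x₃)
  have zl₁l₃ : (⟨l₁, ml₁⟩ : Λ) * ⟨l₃, ml₃⟩ = 0 := Subtype.ext (by subst hl₁ hl₃; exact table_zero_sl x₀ x₂ x₁)
  have zl₂l₄ : (⟨l₂, ml₂⟩ : Λ) * ⟨l₄, ml₄⟩ = 0 := Subtype.ext (by subst hl₂ hl₄; exact table_zero_sl x₀ x₃ x₁)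
  have zl₃l₄ : (⟨l₃, ml₃⟩ : Λ) * ⟨l₄, ml₄⟩ = 0 := Subtype.ext (by subst hl₃ hl₄; exact table_zero_ff x₁ x₂ x₃)
  have pl₁l₄ : (⟨l₁, ml₁⟩ : Λ) * ⟨l₄, ml₄⟩ = -(⟨h₀, mh₀⟩ * ⟨h₁, mh₁⟩) :=
    Subtype.ext (by subst hl₁ hl₄ hh₀ hh₁; exact (table_signed x₀ x₁ x₂ x₃).1)
  have pl₂l₃ : (⟨l₂, ml₂⟩ : Λ) * ⟨l₃, ml₃⟩ = ⟨h₀, mh₀⟩ * ⟨h₁, mh₁⟩ :=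
    Subtype.ext (by subst hl₂ hl₃ hh₀ hh₁; exact (table_signed x₀ x₁ x₂ x₃).2)
  subst hH hH₂ hS₁ hS₄ hG hN hF hϖ hC
  have key := congrArg Subtype.val
    (obstruction_frame (R := Λ) ⟨h₀, mh₀⟩ ⟨h₁, mh₁⟩ ⟨l₁, ml₁⟩ ⟨l₂, ml₂⟩ ⟨l₃, ml₃⟩ ⟨l₄, ml₄⟩ ⟨h₂, mh₂⟩
      ⟨h₃, mh₃⟩ ⟨h₄, mh₄⟩ ⟨h₅, mh₅⟩ ⟨p, mp⟩ ⟨m, mm⟩ _ ⟨n₁, mn₁⟩ ⟨n₂, mn₂⟩ ⟨n₃, mn₃⟩ ⟨n₄, mn₄⟩ ⟨c₁, mc₁⟩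
      ⟨c₂, mc₂⟩ ⟨c₃, mc₃⟩ ⟨c₄, mc₄⟩ ⟨β₀₁, mβ₀₁⟩ ⟨β₂₃, mβ₂₃⟩ _ _ _ _ _ _ _ _ ⟨X, mX⟩ ⟨W, mW⟩ qh₀ qh₃ qh₄
      qh₅ ql₁ ql₂ ql₃ ql₄ zh₀l₁ zh₀l₂ zh₀l₃ zh₀l₄ zh₁l₁ zh₁l₂ zh₁l₃ zh₁l₄ zl₁l₂ zl₁l₃ zl₂l₄ zl₃l₄ pl₁l₄ pl₂l₃
      rfl rfl rfl rfl rfl rfl rfl rfl rfl (Subtype.ext (by push_cast; exact hX))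
      (Subtype.ext (by push_cast; exact hm)))
  push_cast at key ⊢
  exact key


/-- **LEMMA D(b) in the exterior algebra (the join), type `(2,2,2,2,3,5)`.**  For six slots `hᵢ = ι x_{2i}
ι x_{2i+1}` of `ExteriorAlgebra R M` and parameters `s, t, u` in the 2-vector subalgebra `Λ`, with the clique sums
`P₁, P₂, P₃` of `h₀, …, h₃`, the closed forms `D, D₂, D₃`, the registered `T₃(P₁)` and the σ's DEFINED as in
`T3_Km2235_frame`: `CliqueUnitKills.T3_Km2235`'s identity holds, the squares `hᵢ² = 0` being
`TwoSlotFrameTable.twoVector_mul_self`.  The (V)-kill reading stays pencil. -/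
theorem T3_Km2235_exterior (x₀ x₁ x₂ x₃ x₄ x₅ x₆ x₇ x₈ x₉ x₁₀ x₁₁ : M)
    (Λ : Subalgebra R (ExteriorAlgebra R M)) (h₀ h₁ h₂ h₃ h₄ h₅ σ₀ σ₁ σ₂ σ₃ s t u P₁ P₂ P₃ D D₂ D₃ T₃
    : ExteriorAlgebra R M) (hΛ : Λ = Algebra.adjoin R (Set.range fun p : M × M => ι R p.1 * ι R p.2))
    (hh₀ : h₀ = ι R x₀ * ι R x₁) (hh₁ : h₁ = ι R x₂ * ι R x₃) (hh₂ : h₂ = ι R x₄ * ι R x₅)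
    (hh₃ : h₃ = ι R x₆ * ι R x₇) (hh₄ : h₄ = ι R x₈ * ι R x₉) (hh₅ : h₅ = ι R x₁₀ * ι R x₁₁)
    (ms : s ∈ Λ) (mt : t ∈ Λ) (mu : u ∈ Λ) (hP₁ : P₁ = h₀ + h₁ + h₂ + h₃)
    (hP₂ : P₂ = h₀ * h₁ + h₀ * h₂ + h₀ * h₃ + h₁ * h₂ + h₁ * h₃ + h₂ * h₃)
    (hP₃ : P₃ = h₀ * h₁ * h₂ + h₀ * h₁ * h₃ + h₀ * h₂ * h₃ + h₁ * h₂ * h₃)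
    (hT₃ : T₃ = σ₃ * D₃ - 4 * σ₂ * (D₂ * P₁) + 16 * σ₁ * (D * P₂) - 64 * σ₀ * P₃)
    (hD : D = 4 * P₁ + 8 * h₄ + 32 * h₅)
    (hD₂ : D₂ = (256) * h₄ * h₅ + (128) * P₁ * h₅ + (32) * P₁ * h₄ + (16) * P₂)
    (hD₃ : D₃ = (1024) * P₁ * h₄ * h₅ + (512) * P₂ * h₅ + (128) * P₂ * h₄ + (64) * P₃)
    (hσ₁ : σ₁ = 0) (hσ₂ : σ₂ = 4 * t - σ₀) (hσ₀ : σ₀ = 2 * s + 1) (hσ₃ : σ₃ = 4 * u) :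
    T₃ = 128 * ((2 * s + 2 * u + 1 - 6 * t) * P₃) + 256 * ((4) * P₁ * h₄ * h₅ + (16) * P₁ * h₄ * h₅
      * u + (-16) * P₁ * h₄ * h₅ * t + (8) * P₁ * h₄ * h₅ * s + (4) * P₂ * h₅ + (8) * P₂ * h₅ * u +
      (-16) * P₂ * h₅ * t + (8) * P₂ * h₅ * s + P₂ * h₄ + (2) * P₂ * h₄ * u + (-4) * P₂ * h₄ * t +
      (2) * P₂ * h₄ * s) := by
  subst hΛ
  haveI := isMulCommutative_twoVectorSubalgebra (R := R) (M := M)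
  set Λ := Algebra.adjoin R (Set.range fun p : M × M => ι R p.1 * ι R p.2)
  have mh₀ : h₀ ∈ Λ := Algebra.subset_adjoin ⟨(x₀, x₁), hh₀.symm⟩
  have mh₁ : h₁ ∈ Λ := Algebra.subset_adjoin ⟨(x₂, x₃), hh₁.symm⟩
  have mh₂ : h₂ ∈ Λ := Algebra.subset_adjoin ⟨(x₄, x₅), hh₂.symm⟩
  have mh₃ : h₃ ∈ Λ := Algebra.subset_adjoin ⟨(x₆, x₇), hh₃.symm⟩
  have mh₄ : h₄ ∈ Λ := Algebra.subset_adjoin ⟨(x₈, x₉), hh₄.symm⟩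
  have mh₅ : h₅ ∈ Λ := Algebra.subset_adjoin ⟨(x₁₀, x₁₁), hh₅.symm⟩
  have qh₀ : (⟨h₀, mh₀⟩ : Λ) * ⟨h₀, mh₀⟩ = 0 := Subtype.ext (by subst hh₀; exact twoVector_mul_self x₀ x₁)
  have qh₁ : (⟨h₁, mh₁⟩ : Λ) * ⟨h₁, mh₁⟩ = 0 := Subtype.ext (by subst hh₁; exact twoVector_mul_self x₂ x₃)
  have qh₂ : (⟨h₂, mh₂⟩ : Λ) * ⟨h₂, mh₂⟩ = 0 := Subtype.ext (by subst hh₂; exact twoVector_mul_self x₄ x₅)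
  have qh₃ : (⟨h₃, mh₃⟩ : Λ) * ⟨h₃, mh₃⟩ = 0 := Subtype.ext (by subst hh₃; exact twoVector_mul_self x₆ x₇)
  subst hP₁ hP₂ hP₃ hT₃ hD hD₂ hD₃ hσ₁ hσ₂ hσ₀ hσ₃
  have key := congrArg Subtype.val
    (T3_Km2235_frame (R := Λ) ⟨h₀, mh₀⟩ ⟨h₁, mh₁⟩ ⟨h₂, mh₂⟩ ⟨h₃, mh₃⟩ ⟨h₄, mh₄⟩ ⟨h₅, mh₅⟩ _ _ _ _
      ⟨s, ms⟩ ⟨t, mt⟩ ⟨u, mu⟩ _ _ _ _ _ _ _ qh₀ qh₁ qh₂ qh₃ rfl rfl rfl rfl rfl rfl rfl rfl rfl rfl rfl)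
  push_cast at key ⊢
  exact key

end Exterior

end Summit.Ventures.HSemireg.TwoSlotGlue
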